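import Mathlib
import HarnessLib
import Summits.HubbardSuperconductivity.HubbardSuperconductivity.Theorems.WeakCouplingBCSDefsKlU0Record

/-!
# Route `WeakCouplingBCS` — channel-margin lane of the Kohn–Luttinger certificate (`WcbcsKohnLuttingerB1g`,
# stmt-HubbardSuperconductivity-0158): WINDOW vocabulary for the explicit-`U₀` rows

The `U₀` rows of `Theorems/WeakCouplingBCSDefsKlU0Record.lean` (`KLU0Row`, kernel check `KLU0Row.ok`, soundness `klU0Row_sound`)
each live at ONE chemical potential or on ONE `μ`-cell.  To state «`B1g` selection survives the higher orders of the pp-irreducible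
Cooper vertex for `0 < U ≤ U₀` at EVERY `μ` of a window» one needs a finite cover of the window by boxes, each carrying a row whose
expansion bounds (the row's named hypotheses: second-order enclosures, chain bounds, two-loop allowances) are certified UNIFORMLY on
the box.  This file is that vocabulary, in the style of the window certificates `KLCert.checkB1gD` / `klb1gd_window` of the
second-order lane (`Theorems/WeakCouplingBCSWcbcsKohnLuttingerB1gKlCertFormD.lean`):
* `KLU0WinRow` = a box `[mulo, muhi]` with a `KLU0Row`;
* `klU0WinCheck mub mua u rows` (kernel-decidable): rows non-empty, first box starts at or below `mub`, last ends at or above `mua`,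
  consecutive boxes contiguous (`klU0WinChain`), every row well formed, passing `KLU0Row.ok`, with `0 < u ≤ U0`;
* `klU0Win_cover` (cover logic, induction on the list) and `klU0Win_sound` = `klU0Row_sound` on the box containing `μ`:
  ONE threshold `u` for the whole window, modulo the rows' named hypotheses.
The record instance (boxes of the second-order window records `klCertB1gWin{A,B,C}` with certified higher-order allowances on wide
`μ`-cells, margin-1 g6) is `Theorems/WeakCouplingBCSDefsKlU0WindowRecord.lean`; cell file U0-TABLE.md v3 (gate-hubbard-kl).
Nothing here asserts superconductivity.

References: D. J. Scalapino, E. Loh, J. E. Hirsch, Phys. Rev. B 34 (1986) 8190, (3)–(4); M. Reed, B. Simon, *Methods of Modern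
Mathematical Physics IV*, §XIII.1.
-/

noncomputable section

-- the tree's namespace `Summit.<Summit>.<Problem>.Theorems` repeats the summit name by design (D-0017)
set_option linter.dupNamespace false

namespace Summit.HubbardSuperconductivity.HubbardSuperconductivity.Theorems

/-- A WINDOW ROW: a chemical-potential box `[mulo, muhi]` together with a `KLU0Row` whose expansion bounds (the row's named
hypotheses) are certified UNIFORMLY for every `μ` of the box. [folklore] -/
structure KLU0WinRow where
  /-- lower end of the `μ`-box -/
  mulo : ℚ
  /-- upper end of the `μ`-box -/
  muhi : ℚ
  /-- the `U₀` row valid on the box -/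
  row : KLU0Row

/-- A window row is usable with the uniform threshold `u`: the box is well formed, the row passes `KLU0Row.ok`, and `u ≤ U0`.
[folklore] -/
def KLU0WinRow.okAt (u : ℚ) (r : KLU0WinRow) : Bool :=
  decide (r.mulo ≤ r.muhi) && r.row.ok && decide (0 < u) && decide (u ≤ r.row.U0)

/-- Consecutive boxes are contiguous: each box starts no later than the previous one ends. [folklore] -/
def klU0WinChain : List KLU0WinRow → Bool
  | [] => true
  | [_] => true
  | r :: s :: t => decide (s.mulo ≤ r.muhi) && klU0WinChain (s :: t)

/-- **The window checker.** The rows are non-empty, the first box starts at or below `mub`, the last ends at or above `mua`,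
the boxes are contiguous, and every row is usable with the uniform threshold `u`.  Kernel-decidable. [folklore] -/
def klU0WinCheck (mub mua u : ℚ) (l : List KLU0WinRow) : Bool :=
  (match l.head?, l.getLast? with
    | some a, some b => decide (a.mulo ≤ mub) && decide (mua ≤ b.muhi)
    | _, _ => false) &&
  klU0WinChain l && l.all (KLU0WinRow.okAt u)

/-- **Chain cover.** If the boxes `r₀ :: L` are contiguous and `r₁` is the last one, every real `μ` with
`r₀.mulo ≤ μ ≤ r₁.muhi` lies in one of the boxes. [folklore] -/
theorem klU0Win_chain_cover : ∀ (L : List KLU0WinRow) (r₀ r₁ : KLU0WinRow), klU0WinChain (r₀ :: L) = true →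
    (r₀ :: L).getLast? = some r₁ →
    ∀ μ : ℝ, ((r₀.mulo : ℚ) : ℝ) ≤ μ → μ ≤ ((r₁.muhi : ℚ) : ℝ) →
    ∃ r ∈ r₀ :: L, ((r.mulo : ℚ) : ℝ) ≤ μ ∧ μ ≤ ((r.muhi : ℚ) : ℝ) := by
  intro L
  induction L with
  | nil =>
    intro r₀ r₁ _ hlast μ h₁ h₂
    have hb : r₁ = r₀ := by simpa [eq_comm] using hlast
    subst hb
    exact ⟨r₁, List.mem_cons_self, h₁, h₂⟩
  | cons b L ih =>
    intro r₀ r₁ hch hlast μ h₁ h₂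
    simp only [klU0WinChain, Bool.and_eq_true, decide_eq_true_eq] at hch
    rw [List.getLast?_cons_cons] at hlast
    by_cases hμ : μ ≤ ((r₀.muhi : ℚ) : ℝ)
    · exact ⟨r₀, List.mem_cons_self, h₁, hμ⟩
    · have hb : ((b.mulo : ℚ) : ℝ) ≤ μ := by
        have h' : ((b.mulo : ℚ) : ℝ) ≤ ((r₀.muhi : ℚ) : ℝ) := by exact_mod_cast hch.1
        exact h'.trans (le_of_lt (lt_of_not_ge hμ))
      obtain ⟨r, hr, hr'⟩ := ih b r₁ hch.2 hlast μ hb h₂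
      exact ⟨r, List.mem_cons_of_mem _ hr, hr'⟩

/-- **Cover logic of the window checker.** If `klU0WinCheck mub mua u l = true` then `0 < u` and every real `μ ∈ [mub, mua]`
lies in the box of some row `r ∈ l` with `r.row.ok = true` and `u ≤ r.row.U0`. [folklore] -/
theorem klU0Win_cover (mub mua u : ℚ) (l : List KLU0WinRow) (h : klU0WinCheck mub mua u l = true) :
    0 < u ∧ ∀ μ : ℝ, ((mub : ℚ) : ℝ) ≤ μ → μ ≤ ((mua : ℚ) : ℝ) →
      ∃ r ∈ l, ((r.mulo : ℚ) : ℝ) ≤ μ ∧ μ ≤ ((r.muhi : ℚ) : ℝ) ∧ r.row.ok = true ∧ u ≤ r.row.U0 := by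
  unfold klU0WinCheck at h
  simp only [Bool.and_eq_true] at h
  obtain ⟨⟨hmatch, hchain⟩, hall⟩ := h
  split at hmatch
  · rename_i a b ha hb
    simp only [Bool.and_eq_true, decide_eq_true_eq] at hmatch
    obtain ⟨L, hL⟩ := List.head?_eq_some_iff.1 ha
    rw [hL] at hchain hb hall ⊢
    have hu : 0 < u := by
      have h0 := List.all_eq_true.1 hall a List.mem_cons_self
      simp only [KLU0WinRow.okAt, Bool.and_eq_true, decide_eq_true_eq] at h0
      exact h0.1.2
    refine ⟨hu, ?_⟩
    intro μ hμ₁ hμ₂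
    have hlo : ((a.mulo : ℚ) : ℝ) ≤ μ := le_trans (by exact_mod_cast hmatch.1) hμ₁
    have hhi : μ ≤ ((b.muhi : ℚ) : ℝ) := le_trans hμ₂ (by exact_mod_cast hmatch.2)
    obtain ⟨r, hr, hr₁, hr₂⟩ := klU0Win_chain_cover L a b hchain hb μ hlo hhi
    have hok := List.all_eq_true.1 hall r hr
    simp only [KLU0WinRow.okAt, Bool.and_eq_true, decide_eq_true_eq] at hok
    exact ⟨r, hr, hr₁, hr₂, hok.1.1.2, hok.2⟩
  · exact absurd hmatch Bool.false_ne_true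

/-- **The window statement, modulo the rows' named hypotheses.** If `klU0WinCheck mub mua u l = true` then for every
`μ ∈ [mub, mua]` there is a row `r ∈ l` whose box contains `μ` such that, for ANY real functions `lamB, lamX` obeying the
expansion bounds of `r.row` against a competitor `c ∈ r.row.chans` on `0 < U ≤ U1` (intended: the `B1g` and `χ` channel
bottoms of `Γ_U/U²` at the level `μ` — the bounds are certified uniformly on the box), `lamB U < lamX U` for all
`0 < U ≤ u`: ONE coupling threshold `u` for the whole window. [folklore] -/
theorem klU0Win_sound (mub mua u : ℚ) (l : List KLU0WinRow) (h : klU0WinCheck mub mua u l = true) :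
    ∀ μ : ℝ, ((mub : ℚ) : ℝ) ≤ μ → μ ≤ ((mua : ℚ) : ℝ) →
      ∃ r ∈ l, ((r.mulo : ℚ) : ℝ) ≤ μ ∧ μ ≤ ((r.muhi : ℚ) : ℝ) ∧
        ∀ c ∈ r.row.chans, ∀ lamB lamX : ℝ → ℝ,
          (∀ U : ℝ, 0 < U → U ≤ r.row.U1 → lamB U ≤ r.row.rhohi + U * (r.row.c3B + r.row.tB) + U ^ 2 * (r.row.c4B + r.row.C4)) →
          (∀ U : ℝ, 0 < U → U ≤ r.row.U1 → (c.low : ℝ) - U * (c.s3 + c.t) - U ^ 2 * (c.s4 + r.row.C4) ≤ lamX U) →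
          ∀ U : ℝ, 0 < U → U ≤ u → lamB U < lamX U := by
  obtain ⟨_, hcov⟩ := klU0Win_cover mub mua u l h
  intro μ hμ₁ hμ₂
  obtain ⟨r, hr, h₁, h₂, hok, hu⟩ := hcov μ hμ₁ hμ₂
  refine ⟨r, hr, h₁, h₂, ?_⟩
  intro c hc lamB lamX hB hχ U hU hUu
  have hUu' : U ≤ (r.row.U0 : ℝ) := le_trans hUu (by exact_mod_cast hu)
  exact klU0Row_sound r.row hok c hc lamB lamX hB hχ U hU hUu'

end Summit.HubbardSuperconductivity.HubbardSuperconductivity.Theorems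

end
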